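import Summits.SmoothPoincare4.SmoothPoincare4.Theorems.CylinderEntropyCylinderRungTwoFluxIdentityCharts
import HarnessLib

/-!
# Flux identity, part 3: the multiplicity area formula for the shadow; the cone over the critical shadow

Part of the proof of the stub `stub_fluxIdentity` (the FLUX IDENTITY `|∫_M ν₅ d(ι^*μH⁴)| = μH⁴(S⁴)`
for connected compact cross-sections of `N = S⁴ × ℝ ⊂ ℝ⁶`) of line `killing-flux` of the crux
`CylinderEntropy.CylinderRungTwo` (stmt-SmoothPoincare4-7631); see the final file
`CylinderEntropyCylinderRungTwoFluxIdentity.lean` for the overall argument. Everything here is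
proved (no named facts); theorems only.

* `exists_regular_partition`, `lintegral_abs_nu5_eq_lintegral_encard` — Federer 3.2.3 with
  multiplicities for the shadow `truncL ∘ ι`: `∫_P |ν₅| d(ι^*𝓗⁴) = ∫ #(shadow⁻¹{p} ∩ P) d𝓗⁴(p)`
  for `P ⊆ {ν₅ ≠ 0}` (countable partition into injectivity pieces + counting), with measurability
  of the multiplicity;
* `volume_cone_shadow_critical_eq_zero` — the cone over the shadow of a critical chart piece
  (`ν₅ = 0`) is Lebesgue-null in `ℝ⁵` (Mathlib's degenerate change of variables).
-/

-- the prescribed namespace `Summit.SmoothPoincare4.SmoothPoincare4.…` repeats `SmoothPoincare4`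
set_option linter.dupNamespace false

noncomputable section

open MeasureTheory Set Function Filter Module
open scoped Manifold ContDiff ENNReal Topology RealInnerProductSpace NNReal

namespace Summit.SmoothPoincare4.SmoothPoincare4.Theorems.CylinderRungTwo.KillingFlux

open Literature.Geometry.Riemannian
open Literature.Geometry.Lorentzian Literature.Geometry.Lorentzian.PseudoRiemannianMetric
open Literature.Geometry.Riemannian.SphericalCylinderEntropy (truncL truncL_apply lipschitz_truncL
  hausdorffMeasure_sphere_four_pos hausdorffMeasure_sphere_four_lt_top)
open Literature.Geometry.Manifold.CylinderSlice (axis castSucc_ne_five)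

section AreaPieces

open Literature.Geometry.GeometricMeasureTheory

variable {M : Type} [TopologicalSpace M] [ChartedSpace (EuclideanSpace ℝ (Fin 4)) M] [IsManifold (𝓡 4) ∞ M]

variable [CompactSpace M] [MeasurableSpace M] [BorelSpace M]

omit [IsManifold (𝓡 4) ∞ M] [CompactSpace M] in
/-- Under the hypotheses of `measure_shadow_piece`, the shadow of the piece is a Borel set
(Lusin–Souslin in the chart). [folklore] -/
theorem measurableSet_shadow_piece {ι : M → (EuclideanSpace ℝ (Fin 6))}
    (hι : Manifold.IsSmoothEmbedding (𝓡 4) (𝓡 6) ∞ ι)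
    (x₀ : M) {V S : Set M} (hVx : V ⊆ (extChartAt (𝓡 4) x₀).source)
    (hinj : InjOn (fun x => truncL (ι x)) V) (hS : MeasurableSet S) (hSV : S ⊆ V) :
    MeasurableSet ((fun x => truncL (ι x)) '' S) := by
  set φ := extChartAt (𝓡 4) x₀ with hφ
  have hSx : S ⊆ φ.source := hSV.trans hVx
  set U : Set (EuclideanSpace ℝ (Fin 4)) := φ.target ∩ φ.symm ⁻¹' V with hUdef
  have hUt : U ⊆ φ.target := inter_subset_left
  have hφV : φ '' V = U := φ.image_eq_target_inter_inv_preimage hVx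
  have hinjU : InjOn (fun u => truncL (((ι ∘ (extChartAt (𝓡 4) x₀).symm)) u)) U := by
    rintro u ⟨hu, huV⟩ u' ⟨hu', hu'V⟩ h
    have := hinj huV hu'V h
    rw [← φ.right_inv hu, ← φ.right_inv hu', this]
  have hS' : MeasurableSet (φ '' S) := measurableSet_image_extChartAt x₀ hS hSx
  have hS'U : φ '' S ⊆ U := hφV ▸ image_mono hSV
  have hcont : ContinuousOn (fun u => truncL (((ι ∘ (extChartAt (𝓡 4) x₀).symm)) u)) U :=
    truncL.continuous.comp_continuousOn
      ((hι.contMDiff.continuous.comp_continuousOn (continuousOn_extChartAt_symm x₀)).mono hUt)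
  have himage : (fun u => truncL (((ι ∘ (extChartAt (𝓡 4) x₀).symm)) u)) '' (φ '' S) = (fun x => truncL (ι
        x)) '' S := by
    rw [image_image]
    refine image_congr fun z hz => ?_
    show truncL (ι (φ.symm (φ z))) = truncL (ι z)
    rw [φ.left_inv (hSx hz)]
  rw [← himage]
  exact hS'.image_of_continuousOn_injOn (hcont.mono hS'U) (hinjU.mono hS'U)

variable [SecondCountableTopology M] [Nonempty M]

omit [CompactSpace M] [MeasurableSpace M] [BorelSpace M] in
/-- **A countable measurable partition of the regular set `{ν₅ ≠ 0}` into injectivity pieces**: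
pieces `S n ⊆ V n`, `V n` open inside a chart domain, with the shadow injective and `ν₅ ≠ 0` on
`V n` (Lindelöf + disjointification of the neighbourhoods of `exists_injOn_nhd_of_regular`).
[folklore] -/
theorem exists_regular_partition [MeasurableSpace M] [BorelSpace M] {ι ν : M → (EuclideanSpace ℝ (Fin 6))}
    (hι : Manifold.IsSmoothEmbedding (𝓡 4) (𝓡 6) ∞ ι)
    (hιN : ∀ x, ∑ i : Fin 5, ι x (Fin.castSucc i) ^ 2 = 1)
    (hνc : Continuous ν) (hνn : (euclideanMetric (EuclideanSpace ℝ (Fin 6))).IsUnitNormal (𝓡 4) ι ν 1)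
    (hνt : ∀ x, ∑ i : Fin 5, ν x (Fin.castSucc i) * ι x (Fin.castSucc i) = 0) :
    ∃ (c : ℕ → M) (V S : ℕ → Set M),
      (∀ n, IsOpen (V n) ∧ V n ⊆ (extChartAt (𝓡 4) (c n)).source ∧
        InjOn (fun y => truncL (ι y)) (V n) ∧ ∀ y ∈ V n, ν y 5 ≠ 0) ∧
      (∀ n, MeasurableSet (S n) ∧ S n ⊆ V n) ∧ Pairwise (Disjoint on S) ∧
      (⋃ n, S n) = {x | ν x 5 ≠ 0} := by
  classical
  set 𝒱 : Set (Set M) := {V | IsOpen V ∧ ∃ c : M, V ⊆ (extChartAt (𝓡 4) c).source ∧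
    InjOn (fun y => truncL (ι y)) V ∧ ∀ y ∈ V, ν y 5 ≠ 0} with h𝒱
  obtain ⟨T, hTc, hT𝒱, hTU⟩ := TopologicalSpace.isOpen_sUnion_countable 𝒱 fun V hV => hV.1
  have hT'c : (insert ∅ T).Countable := hTc.insert ∅
  obtain ⟨V, hV⟩ := hT'c.exists_eq_range (insert_nonempty ∅ T)
  have hVmem : ∀ n, V n ∈ insert ∅ T := fun n => hV ▸ mem_range_self n
  have hprop : ∀ n, IsOpen (V n) ∧ ∃ c : M, V n ⊆ (extChartAt (𝓡 4) c).source ∧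
      InjOn (fun y => truncL (ι y)) (V n) ∧ ∀ y ∈ V n, ν y 5 ≠ 0 := by
    intro n
    rcases hVmem n with h | h
    · rw [h]
      exact ⟨isOpen_empty, Classical.arbitrary M, empty_subset _, injOn_empty _, fun y hy => hy.elim⟩
    · exact hT𝒱 h
  choose hVo c hVc hVinj hVreg using hprop
  refine ⟨c, V, disjointed V, fun n => ⟨hVo n, hVc n, hVinj n, hVreg n⟩,
    fun n => ⟨MeasurableSet.disjointed (fun k => (hVo k).measurableSet) n, disjointed_subset V n⟩,
    disjoint_disjointed V, ?_⟩
  rw [iUnion_disjointed]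
  apply Subset.antisymm
  · exact iUnion_subset fun n y hy => hVreg n y hy
  · intro x hx
    obtain ⟨W, hWo, hxW, hWc, hWinj, hWreg⟩ := exists_injOn_nhd_of_regular hι hιN hνc hνn hνt hx
    have hW𝒱 : W ∈ 𝒱 := ⟨hWo, x, hWc, hWinj, hWreg⟩
    have hxU : x ∈ ⋃₀ T := by rw [hTU]; exact ⟨W, hW𝒱, hxW⟩
    obtain ⟨W', hW'T, hxW'⟩ := hxU
    have : W' ∈ range V := by rw [← hV]; exact mem_insert_of_mem _ hW'T
    obtain ⟨n, rfl⟩ := this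
    exact mem_iUnion.2 ⟨n, hxW'⟩

/-- **The multiplicity form of the area formula for the shadow, on a sign piece.** For the
set `P` = `{ν₅ > 0}` or `{ν₅ < 0}`:
`∫_P |ν₅| d(ι^*𝓗⁴) = ∫ #(shadow⁻¹{p} ∩ P) d𝓗⁴(p)` — sum the injective area formula over a
countable partition into injectivity pieces and count (Federer 3.2.3 with multiplicities, for this
map). [cite: Federer1969, 3.2.3] -/
theorem lintegral_abs_nu5_eq_lintegral_encard {ι ν : M → (EuclideanSpace ℝ (Fin 6))}
    (hι : Manifold.IsSmoothEmbedding (𝓡 4) (𝓡 6) ∞ ι)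
    (hιN : ∀ x, ∑ i : Fin 5, ι x (Fin.castSucc i) ^ 2 = 1)
    (hνc : Continuous ν) (hνn : (euclideanMetric (EuclideanSpace ℝ (Fin 6))).IsUnitNormal (𝓡 4) ι ν 1)
    (hνt : ∀ x, ∑ i : Fin 5, ν x (Fin.castSucc i) * ι x (Fin.castSucc i) = 0)
    {P : Set M} (hPm : MeasurableSet P) (hP : P ⊆ {x | ν x 5 ≠ 0}) :
    Measurable (fun p : (EuclideanSpace ℝ (Fin 5)) => (((fun x => truncL (ι x)) ⁻¹' {p} ∩ P).encard : ℝ≥0∞)) ∧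
    ∫⁻ x in P, ENNReal.ofReal |ν x 5| ∂(Measure.comap ι (μHE[4] : Measure (EuclideanSpace ℝ (Fin 6)))) =
      ∫⁻ p, (((fun x => truncL (ι x)) ⁻¹' {p} ∩ P).encard : ℝ≥0∞) ∂(μHE[4] : Measure (EuclideanSpace ℝ (Fin
            5))) := by
  classical
  obtain ⟨c, V, S, hV, hS, hdisj, hUnion⟩ := exists_regular_partition hι hιN hνc hνn hνt
  set σ : M → (EuclideanSpace ℝ (Fin 5)) := fun x => truncL (ι x) with hσ
  -- the refined partition `S n ∩ P` of `P`
  have hSP : ∀ n, MeasurableSet (S n ∩ P) ∧ S n ∩ P ⊆ V n := fun n =>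
    ⟨(hS n).1.inter hPm, inter_subset_left.trans (hS n).2⟩
  have hdisjP : Pairwise (Disjoint on fun n => S n ∩ P) := fun i j hij =>
    (hdisj hij).mono inter_subset_left inter_subset_left
  have hUnionP : (⋃ n, S n ∩ P) = P := by
    rw [← iUnion_inter, hUnion]
    exact inter_eq_self_of_subset_right hP
  have himgm : ∀ n, MeasurableSet (σ '' (S n ∩ P)) := fun n =>
    measurableSet_shadow_piece hι (c n) (hV n).2.1 (hV n).2.2.1 (hSP n).1 (hSP n).2
  -- counting: `∑ₙ 1_{σ(Sₙ ∩ P)}(p) = #{n | p ∈ σ(Sₙ ∩ P)} = #(σ⁻¹{p} ∩ P)`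
  have hcount : ∀ p : (EuclideanSpace ℝ (Fin 5)), (∑' n, (σ '' (S n ∩ P)).indicator (1 : (EuclideanSpace ℝ (Fin 5))
        → ℝ≥0∞) p) =
      ((σ ⁻¹' {p} ∩ P).encard : ℝ≥0∞) := by
    intro p
    have hpt : ∀ n, (σ '' (S n ∩ P)).indicator (1 : (EuclideanSpace ℝ (Fin 5)) → ℝ≥0∞) p =
        {n | p ∈ σ '' (S n ∩ P)}.indicator (fun _ => (1 : ℝ≥0∞)) n := by
      intro n
      by_cases h : p ∈ σ '' (S n ∩ P)
      · rw [indicator_of_mem h, indicator_of_mem (show n ∈ {n | p ∈ σ '' (S n ∩ P)} from h)]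
        rfl
      · rw [indicator_of_notMem h,
          indicator_of_notMem (show n ∉ {n | p ∈ σ '' (S n ∩ P)} from h)]
    rw [tsum_congr hpt, ← tsum_subtype {n | p ∈ σ '' (S n ∩ P)} (fun _ => (1 : ℝ≥0∞)),
      ENNReal.tsum_set_one]
    congr 1
    -- the index map
    have hex : ∀ x ∈ σ ⁻¹' {p} ∩ P, ∃ n, x ∈ S n := by
      intro x hx
      have : x ∈ ⋃ n, S n := by rw [hUnion]; exact hP hx.2
      exact mem_iUnion.1 this
    set idx : M → ℕ := fun x => if h : ∃ n, x ∈ S n then Nat.find h else 0 with hidx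
    have hidx_spec : ∀ x ∈ σ ⁻¹' {p} ∩ P, x ∈ S (idx x) := by
      intro x hx
      simp only [hidx, dif_pos (hex x hx)]
      exact Nat.find_spec (hex x hx)
    have hidx_eq : ∀ x n, x ∈ S n → idx x = n := by
      intro x n hxn
      have h : ∃ n, x ∈ S n := ⟨n, hxn⟩
      simp only [hidx, dif_pos h]
      by_contra hne
      exact Set.disjoint_left.1 (hdisj hne) (Nat.find_spec h) hxn
    have hinj : InjOn idx (σ ⁻¹' {p} ∩ P) := by
      intro x hx y hy hxy
      have hxS := hidx_spec x hx
      have hyS := hidx_spec y hy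
      rw [hxy] at hxS
      refine (hV (idx y)).2.2.1 ((hS _).2 hxS) ((hS _).2 hyS) ?_
      show σ x = σ y
      rw [show σ x = p from hx.1, show σ y = p from hy.1]
    have himage : idx '' (σ ⁻¹' {p} ∩ P) = {n | p ∈ σ '' (S n ∩ P)} := by
      apply Subset.antisymm
      · rintro _ ⟨x, hx, rfl⟩
        exact ⟨x, ⟨hidx_spec x hx, hx.2⟩, hx.1⟩
      · rintro n ⟨x, ⟨hxS, hxP⟩, hxp⟩
        exact ⟨x, ⟨hxp, hxP⟩, hidx_eq x n hxS⟩
    rw [← himage, hinj.encard_image]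
  refine ⟨?_, ?_⟩
  · -- measurability from the series representation
    have : (fun p : (EuclideanSpace ℝ (Fin 5)) => ((σ ⁻¹' {p} ∩ P).encard : ℝ≥0∞)) =
        fun p => ∑' n, (σ '' (S n ∩ P)).indicator (1 : (EuclideanSpace ℝ (Fin 5)) →
              ℝ≥0∞) p := funext fun p => (hcount p).symm
    rw [this]
    exact Measurable.tsum fun n => measurable_one.indicator (himgm n)
  -- sum the injective area formula over the pieces
  calc ∫⁻ x in P, ENNReal.ofReal |ν x 5| ∂(Measure.comap ι (μHE[4] : Measure (EuclideanSpace ℝ (Fin 6))))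
      = ∑' n, ∫⁻ x in S n ∩ P, ENNReal.ofReal |ν x 5| ∂(Measure.comap ι (μHE[4] : Measure (EuclideanSpace ℝ (Fin
            6)))) := by
        rw [← lintegral_iUnion (fun n => (hSP n).1) hdisjP, hUnionP]
    _ = ∑' n, (μHE[4] : Measure (EuclideanSpace ℝ (Fin 5))) (σ '' (S n ∩ P)) := by
        refine tsum_congr fun n => ?_
        rw [measure_shadow_piece hι hιN hνc hνn hνt (c n) (hV n).1 (hV n).2.1 (hV n).2.2.1
          (hV n).2.2.2 (hSP n).1 (hSP n).2]
    _ = ∑' n, ∫⁻ p, (σ '' (S n ∩ P)).indicator 1 p ∂(μHE[4] : Measure (EuclideanSpace ℝ (Fin 5))) := by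
        refine tsum_congr fun n => ?_
        rw [lintegral_indicator_one (himgm n)]
    _ = ∫⁻ p, ∑' n, (σ '' (S n ∩ P)).indicator 1 p ∂(μHE[4] : Measure (EuclideanSpace ℝ (Fin 5))) := by
        rw [lintegral_tsum fun n => ((measurable_one.indicator (himgm n)).aemeasurable)]
    _ = ∫⁻ p, ((σ ⁻¹' {p} ∩ P).encard : ℝ≥0∞) ∂(μHE[4] : Measure (EuclideanSpace ℝ (Fin 5))) :=
        lintegral_congr fun p => hcount p

end AreaPieces

/-! ## §4 The shadow of the critical set `{ν₅ = 0}` is `𝓗⁴`-null (a Sard-type lemma via cones) -/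

section CriticalNull

open Literature.Geometry.GeometricMeasureTheory

open scoped Pointwise

variable {M : Type} [TopologicalSpace M] [ChartedSpace (EuclideanSpace ℝ (Fin 4)) M] [IsManifold (𝓡 4) ∞ M]

/-- **The cone over the shadow of a critical chart piece is Lebesgue-null in `ℝ⁵`.** For
`Z ⊆ {ν₅ = 0}` inside the chart domain at `x₀`, the cone map
`G(w) = w₄ · shadow(φ⁻¹(w₀,…,w₃))` on `{(u, r) | u ∈ φ Z, 0 < r < 1}` has everywhere singular
differential (the shadow's chart differential `truncL ∘ DΦ` kills a vector where `ν₅ = 0`), so its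
image `(0,1) · shadow(Z)` is null (Mathlib's `addHaar_image_eq_zero_of_det_fderivWithin_eq_zero`).
[folklore] -/
theorem volume_cone_shadow_critical_eq_zero {ι ν : M → (EuclideanSpace ℝ (Fin 6))}
    (hι : Manifold.IsSmoothEmbedding (𝓡 4) (𝓡 6) ∞ ι)
    (hιN : ∀ x, ∑ i : Fin 5, ι x (Fin.castSucc i) ^ 2 = 1)
    (hνn : (euclideanMetric (EuclideanSpace ℝ (Fin 6))).IsUnitNormal (𝓡 4) ι ν 1)
    (hνt : ∀ x, ∑ i : Fin 5, ν x (Fin.castSucc i) * ι x (Fin.castSucc i) = 0)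
    (x₀ : M) {Z : Set M} (hZx : Z ⊆ (extChartAt (𝓡 4) x₀).source) (hZ : ∀ x ∈ Z, ν x 5 = 0) :
    (volume : Measure (EuclideanSpace ℝ (Fin 5))) (Ioo (0 : ℝ) 1 • ((fun x => truncL (ι x)) '' Z)) = 0 := by
  set π4 : EuclideanSpace ℝ (Fin 5) →L[ℝ] EuclideanSpace ℝ (Fin 4) :=
    ((EuclideanSpace.equiv (Fin 4) ℝ).symm.toContinuousLinearMap.comp
      (ContinuousLinearMap.pi fun i : Fin 4 => (EuclideanSpace.proj (Fin.castSucc i) :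
        EuclideanSpace ℝ (Fin 5) →L[ℝ] ℝ))) with hπ4def
  have pi4_apply : ∀ (w : EuclideanSpace ℝ (Fin 5)) (i : Fin 4), π4 w i = w (Fin.castSucc i) :=
    fun w i => by simp [hπ4def]
  set φ := extChartAt (𝓡 4) x₀ with hφ
  set g : (EuclideanSpace ℝ (Fin 4)) → (EuclideanSpace ℝ (Fin 5)) := fun u => truncL (((ι ∘ (extChartAt (𝓡 4)
        x₀).symm)) u) with hg
  set r4 : (EuclideanSpace ℝ (Fin 5)) →L[ℝ] ℝ := EuclideanSpace.proj (4 : Fin 5) with hr4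
  set G : (EuclideanSpace ℝ (Fin 5)) → (EuclideanSpace ℝ (Fin 5)) := fun w => r4 w • g ((π4) w) with hG
  set D : Set (EuclideanSpace ℝ (Fin 5)) := {w | (π4) w ∈ φ '' Z ∧ r4 w ∈ Ioo (0 : ℝ) 1} with hD
  -- the derivative of `G`
  set G' : (EuclideanSpace ℝ (Fin 5)) → (EuclideanSpace ℝ (Fin 5)) →L[ℝ] (EuclideanSpace ℝ (Fin 5)) := fun w =>
    r4 w • ((truncL.comp (((ContinuousLinearMap.comp (mfderiv (𝓡 4) (𝓡 6) ι ((extChartAt (𝓡 4) x₀).symm ((π4) w)))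
          (mfderivWithin 𝓘(ℝ, EuclideanSpace ℝ (Fin 4)) (𝓡 4) (extChartAt (𝓡 4) x₀).symm (Set.range (𝓡 4)) ((π4)
          w))) : EuclideanSpace ℝ (Fin 4) →L[ℝ] EuclideanSpace ℝ (Fin 6)))).comp (π4)) + r4.smulRight (g ((π4)
          w)) with hG'
  have hderiv : ∀ w ∈ D, HasFDerivWithinAt G (G' w) D w := by
    rintro w ⟨⟨z, hz, hzw⟩, -⟩
    have hut : (π4) w ∈ φ.target := hzw ▸ φ.map_source (hZx hz)
    have h1 : HasFDerivAt (fun w : (EuclideanSpace ℝ (Fin 5)) => g ((π4) w)) ((truncL.comp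
          (((ContinuousLinearMap.comp (mfderiv (𝓡 4) (𝓡 6) ι ((extChartAt (𝓡 4) x₀).symm ((π4) w))) (mfderivWithin
          𝓘(ℝ, EuclideanSpace ℝ (Fin 4)) (𝓡 4) (extChartAt (𝓡 4) x₀).symm (Set.range (𝓡 4)) ((π4) w))) :
          EuclideanSpace ℝ (Fin 4) →L[ℝ] EuclideanSpace ℝ (Fin 6)))).comp (π4)) w :=
      (hasFDerivAt_shadow_chartRep hι x₀ hut).comp w (π4).hasFDerivAt
    have h2 : HasFDerivAt (fun w : (EuclideanSpace ℝ (Fin 5)) => r4 w) r4 w := r4.hasFDerivAt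
    exact (h2.smul h1).hasFDerivWithinAt
  -- the derivative is singular on `D`
  have hdet : ∀ w ∈ D, (G' w).det = 0 := by
    rintro w ⟨⟨z, hz, hzw⟩, -⟩
    have hut : (π4) w ∈ φ.target := hzw ▸ φ.map_source (hZx hz)
    have hν0 : ν (φ.symm ((π4) w)) 5 = 0 := by
      rw [← hzw, φ.left_inv (hZx hz)]; exact hZ z hz
    -- a non-zero kernel vector of `truncL ∘ DΦ`
    have hni : ¬ Injective (truncL.comp (((ContinuousLinearMap.comp (mfderiv (𝓡 4) (𝓡 6) ι ((extChartAt (𝓡 4)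
          x₀).symm ((π4) w))) (mfderivWithin 𝓘(ℝ, EuclideanSpace ℝ (Fin 4)) (𝓡 4) (extChartAt (𝓡 4) x₀).symm
          (Set.range (𝓡 4)) ((π4) w))) : EuclideanSpace ℝ (Fin 4) →L[ℝ] EuclideanSpace ℝ (Fin 6)))) := by
      intro hinj
      have hpos := sqrt_det_gram_pos_of_injective (EuclideanSpace.basisFun (Fin 4) ℝ)
        (truncL.comp (((ContinuousLinearMap.comp (mfderiv (𝓡 4) (𝓡 6) ι ((extChartAt (𝓡 4) x₀).symm ((π4) w)))
              (mfderivWithin 𝓘(ℝ, EuclideanSpace ℝ (Fin 4)) (𝓡 4) (extChartAt (𝓡 4) x₀).symm (Set.range (𝓡 4)) ((π4)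
              w))) : EuclideanSpace ℝ (Fin 4) →L[ℝ] EuclideanSpace ℝ (Fin 6)))) hinj
      have hid := sqrt_det_gram_shadow hι hιN hνn hνt x₀ hut
      rw [hν0, abs_zero, zero_mul] at hid
      exact absurd hid (ne_of_gt hpos)
    obtain ⟨v, hv0, hvne⟩ : ∃ v : (EuclideanSpace ℝ (Fin 4)), (truncL.comp (((ContinuousLinearMap.comp (mfderiv (𝓡
          4) (𝓡 6) ι ((extChartAt (𝓡 4) x₀).symm ((π4) w))) (mfderivWithin 𝓘(ℝ, EuclideanSpace ℝ (Fin 4)) (𝓡 4)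
          (extChartAt (𝓡 4) x₀).symm (Set.range (𝓡 4)) ((π4) w))) : EuclideanSpace ℝ (Fin 4) →L[ℝ] EuclideanSpace ℝ
          (Fin 6)))) v = 0 ∧ v ≠ 0 := by
      by_contra h
      push Not at h
      exact hni ((injective_iff_map_eq_zero _).2 h)
    -- pad it to `ℝ⁵`
    set v' : (EuclideanSpace ℝ (Fin 5)) := WithLp.toLp 2 (Fin.snoc (fun i : Fin 4 => v i) (0 : ℝ)) with hv'
    have hπv' : (π4) v' = v := by
      ext i
      rw [pi4_apply, hv']
      exact Fin.snoc_castSucc (α := fun _ => ℝ) _ _ i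
    have hr4v' : r4 v' = 0 := by
      show (Fin.snoc (fun i : Fin 4 => v i) (0 : ℝ) : Fin 5 → ℝ) (Fin.last 4) = 0
      exact Fin.snoc_last _ _
    have hv'ne : v' ≠ 0 := by
      intro h0
      apply hvne
      rw [← hπv', h0, map_zero]
    have hker : (G' w) v' = 0 := by
      show (r4 w • ((truncL.comp (((ContinuousLinearMap.comp (mfderiv (𝓡 4) (𝓡 6) ι ((extChartAt (𝓡 4) x₀).symm
            ((π4) w))) (mfderivWithin 𝓘(ℝ, EuclideanSpace ℝ (Fin 4)) (𝓡 4) (extChartAt (𝓡 4) x₀).symm (Set.range (𝓡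
            4)) ((π4) w))) : EuclideanSpace ℝ (Fin 4) →L[ℝ] EuclideanSpace ℝ (Fin 6)))).comp (π4)) +
        r4.smulRight (g ((π4) w))) v' = 0
      rw [_root_.add_apply, _root_.smul_apply, ContinuousLinearMap.comp_apply, hπv', hv0, smul_zero,
        zero_add, ContinuousLinearMap.smulRight_apply, hr4v', zero_smul]
    change LinearMap.det ((G' w : (EuclideanSpace ℝ (Fin 5)) →L[ℝ] (EuclideanSpace ℝ (Fin 5))) : (EuclideanSpace ℝ
          (Fin 5)) →ₗ[ℝ] (EuclideanSpace ℝ (Fin 5))) = 0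
    rw [LinearMap.det_eq_zero_iff_ker_ne_bot]
    intro hbot
    exact hv'ne ((LinearMap.ker_eq_bot.1 hbot) (by rw [map_zero]; exact hker))
  have hnull := addHaar_image_eq_zero_of_det_fderivWithin_eq_zero (μ := (volume : Measure (EuclideanSpace ℝ (Fin
        5))))
    hderiv hdet
  -- `G '' D = (0,1) • shadow(Z)`
  have himage : G '' D = Ioo (0 : ℝ) 1 • ((fun x => truncL (ι x)) '' Z) := by
    apply Subset.antisymm
    · rintro _ ⟨w, ⟨⟨z, hz, hzw⟩, hr⟩, rfl⟩
      refine Set.smul_mem_smul hr ⟨z, hz, ?_⟩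
      show truncL (ι z) = g ((π4) w)
      rw [hg, ← hzw]
      show truncL (ι z) = truncL (ι (φ.symm (φ z)))
      rw [φ.left_inv (hZx hz)]
    · rintro _ ⟨r, hr, _, ⟨z, hz, rfl⟩, rfl⟩
      refine ⟨WithLp.toLp 2 (Fin.snoc (fun i : Fin 4 => φ z i) r), ⟨?_, ?_⟩, ?_⟩
      · refine ⟨z, hz, ?_⟩
        ext i
        rw [pi4_apply]
        exact (Fin.snoc_castSucc (α := fun _ => ℝ) _ _ i).symm
      · show (Fin.snoc (fun i : Fin 4 => φ z i) r : Fin 5 → ℝ) (Fin.last 4) ∈ Ioo (0 : ℝ) 1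
        rwa [Fin.snoc_last]
      · have hπ : (π4) (WithLp.toLp 2 (Fin.snoc (fun i : Fin 4 => φ z i) r)) = φ z := by
          ext i
          rw [pi4_apply]
          exact Fin.snoc_castSucc (α := fun _ => ℝ) _ _ i
        have hr' : r4 (WithLp.toLp 2 (Fin.snoc (fun i : Fin 4 => φ z i) r)) = r := by
          show (Fin.snoc (fun i : Fin 4 => φ z i) r : Fin 5 → ℝ) (Fin.last 4) = r
          exact Fin.snoc_last _ _
        show r4 _ • g ((π4) _) = r • truncL (ι z)
        rw [hπ, hr', hg]
        show r • truncL (ι (φ.symm (φ z))) = r • truncL (ι z)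
        rw [φ.left_inv (hZx hz)]
  rw [← himage]
  exact hnull

end CriticalNull

/-- Marker of part 3 (registered sub-goal `stub_fluxIdentity_part3`): the shadow of a measurable
injectivity piece is Borel (`measurableSet_shadow_piece`). [folklore] -/
theorem stub_fluxIdentity_part3 :
    ∀ (M : Type) [TopologicalSpace M] [ChartedSpace (EuclideanSpace ℝ (Fin 4)) M] [MeasurableSpace
      M] [BorelSpace M] (ι : M → EuclideanSpace ℝ (Fin 6)), Manifold.IsSmoothEmbedding (𝓡 4) (𝓡 6)
      ∞ ι → ∀ (x₀ : M) (V S : Set M), V ⊆ (extChartAt (𝓡 4) x₀).source → Set.InjOn (fun x =>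
      Literature.Geometry.Riemannian.SphericalCylinderEntropy.truncL (ι x)) V → MeasurableSet S → S
      ⊆ V → MeasurableSet ((fun x => Literature.Geometry.Riemannian.SphericalCylinderEntropy.truncL
      (ι x)) '' S) :=
  fun _ _ _ _ _ _ hι x₀ _ _ hVx hinj hS hSV => measurableSet_shadow_piece hι x₀ hVx hinj hS hSV

end Summit.SmoothPoincare4.SmoothPoincare4.Theorems.CylinderRungTwo.KillingFlux
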